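/-
Copyright (c) 2026 the pub-hodgecm-mathlib formalisation cell (harness21).  Prover seat hodgecm-mathlib-K2E3-p25 (g2), HCML Track B «K2-LIT»,
h413 = `stmt-HodgeConjecture-24833`, road (11-3-split-nsc), leaf (nsc-S-A′) `sig_K2E3GL3PrincipalBlockStandardSpan` (U12 :463), brick (E4b-2) of the leaf
owner's E4b spec (K2 bus 2026-09-04 11:51Z; dealer D100): the `GL₂`-block of a supercuspidal Levi representation and Casselman's Cor. 5.4.3 on the block.  2026-09-04.
-/
import Summits.HodgeConjecture.HodgeConjecture.Theorems.K2E3CharLocIntNearCentralFactor        -- ★ `exists_character_of_central_factor`, `isIrreducible∕isAdmissible∕isSupercuspidal_comp_inl`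
import Summits.HodgeConjecture.HodgeConjecture.Theorems.K2E3GL3CuspidalBlockRestriction          -- ★ `exists_continuousMulEquiv_levi_two_one`
import Summits.HodgeConjecture.HodgeConjecture.Theorems.K2E3GLnIntegerPointsHaarVsAddHaar         -- ★ `secondCountableTopology_gl`, `locallyCompactSpace_gl`
import Literature.NumberTheory.Automorphic.ParabolicIndGLNoSupercuspidalSubquotient               -- ★ Casselman 5.4.3 `intertwiningMap_subrepresentation_parabolicIndGL_eq_zero`
import Literature.NumberTheory.Automorphic.MatrixCoefficientsSupercuspidalAdmissibleProofs        -- ★ `IsSupercuspidal.isAdmissible_holds`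
import Literature.NumberTheory.Automorphic.SupercuspidalSubrep                                    -- ★ `IsSupercuspidal.comp_mulEquiv`
import Literature.NumberTheory.Automorphic.CongruenceSubgroupExpansionGL                          -- ★ `nonarchimedeanGroup_gl`
import Literature.NumberTheory.Automorphic.ParabolicGLReindex                                     -- ★ `IsSmooth.comp_of_continuous`
import Literature.RepresentationTheory.IrreducibleTwistTransport                                 -- ★ `IsIrreducible.comp_of_surjective`
import HarnessLib

/-!
# K2_E3 road (h413), leaf (nsc-S-A′), brick E4b-2 — a principal series of the `GL₂`-block has no non-zero map from a subrepresentation onto a supercuspidal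
# representation of the two-block Levi (the block form of Casselman's Cor. 5.4.3)

Cell `pub/hodgecm-mathlib` (D-0151), Track B, seat K2E3-p25 (g2) (leaf owner ∕ architect).  `--supports stmt-HodgeConjecture-24833 --as helper`; THEOREMS ONLY
(no `def`, no instance, no notation, no `sorry`); never imports `Cruxes/…/Lines`.  COUNT-NEUTRAL.  This is the `M_c`-level input of the discharge of the weak cell lemma
`h3cell` of ★ E4a `K2E3GL3PrincipalSeriesConstituentsJacquetNonzero` (bricks E4b-1∕E4b-3, K2E3-p14 (g7)).

THE MATHEMATICS ([Casselman1995, Thm. 5.4.1, Cor. 5.4.3]; [BernsteinZelevinsky1977, Thm. 2.4 (b)(d), Cor. 2.13 (b)]; [BushnellHenniart2006, §2.6 Cor. 1, §9.1]).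
Let `M ≅ GL₂(F) × A` with `A` commutative (the two-block Levi `GL₂ × GL₁` of `GL₃(F)`) and `σ` an irreducible smooth SUPERCUSPIDAL representation of `M`.
* §1 **`exists_character_blockData_of_continuousMulEquiv`** — along a topological group isomorphism `E : GL₂(F) × A ≃ M`: `A` acts on `σ` through a smooth character `χ`
  (Schur, ★ `exists_character_of_central_factor`; `σ ∘ E` is admissible by ★ `IsSupercuspidal.isAdmissible_holds`), and the `GL₂`-block `σ₂ := σ ∘ E ∘ inl` is IRREDUCIBLE,
  ADMISSIBLE and SUPERCUSPIDAL (★ `isIrreducible∕isAdmissible∕isSupercuspidal_comp_inl`).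
* §2 **`intertwiningMap_subrepresentation_eq_zero_of_blockEmbedding`** — for ANY homomorphism `ι : GL₂(F) → M` with `σ ∘ ι` irreducible admissible supercuspidal, ANY
  `M`-representation `Y` carrying an INJECTIVE `GL₂`-equivariant linear map `j : Y → I₂(χ₂)` into a principal series of `GL₂(F)`
  (`I₂(χ₂) = parabolicIndGL F (id : Fin 2 → Fin 2) (𝟙.twist χ₂)`, any torus character `χ₂`), every `M`-subrepresentation `N ≤ Y` and every `M`-map
  `q : N → σ`: **`q = 0`** — transport `N`, `q` along `j` to a `GL₂`-subrepresentation of `I₂ x y` mapping onto `σ ∘ ι`, which ★ Casselman 5.4.3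
  (`intertwiningMap_subrepresentation_parabolicIndGL_eq_zero`, `ParabolicIndGLNoSupercuspidalSubquotient`) annihilates.
* §4 (ED. 2) **`intertwiningMap_subrepresentation_eq_zero_of_blockMap`** — the RELATIVE form of §2: `A ≤ V`, a cell map `Ψ : A → I₂(χ₂)` (not injective), `N ≤ A`, `q` killing `N ∩ ker Ψ`.
* §3 **`exists_blockEmbedding_twoOne`** — the instance `M = Π_a GL {i // ![0,0,1] i = a} F`: a block embedding `ι : GL₂(F) → M` with `ι g = proj_Q (diag(g, 1))`
  (★ `exists_continuousMulEquiv_levi_two_one`) such that `σ ∘ ι` is irreducible, admissible and supercuspidal for every irreducible smooth supercuspidal `σ` — the data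
  bricks E4b-1∕E4b-3 feed into §2 cell by cell.

HONEST LABEL: HC_CM is proved only modulo the 7 printed citations (2 remaining named inputs: hLiu418 = stmt-HodgeConjecture-24832, h413 = stmt-HodgeConjecture-24833) until rung 0
closes; count-neutral generic helper.

## References
* [Casselman1995] W. Casselman, *Introduction to the theory of admissible representations of p-adic reductive groups* (draft 1 May 1995), Thm. 5.4.1, Cor. 5.4.3, Prop. 5.1.1.
* [BernsteinZelevinsky1977] I. N. Bernstein, A. V. Zelevinsky, *Induced representations of reductive p-adic groups I*, Ann. Sci. ÉNS 10 (1977), Thm. 2.4 (b)(d), Cor. 2.13 (b).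
* [BushnellHenniart2006] C. J. Bushnell, G. Henniart, *The Local Langlands Conjecture for GL(2)* (2006), §2.6 Corollary 1, §9.1, §10.1.
-/

set_option autoImplicit false
set_option linter.dupNamespace false

noncomputable section

open Function
open scoped MatrixGroups
open Literature.NumberTheory.Automorphic ValuativeRel
open Summit.HodgeConjecture.HodgeConjecture.Cruxes.H413.K2E3CharLocIntNearCentralFactor

namespace Summit.HodgeConjecture.HodgeConjecture.Cruxes.H413.K2E3LeviPrincipalSeriesNoSupercuspidal

variable {F : Type} [Field F] [ValuativeRel F] [TopologicalSpace F] [IsNonarchimedeanLocalField F]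

/-! ## §1 The `GL₂`-block of a supercuspidal representation of `M ≅ GL₂(F) × A` -/

section Block

variable {M : Type} [Group M] [TopologicalSpace M] [IsTopologicalGroup M]
  {A : Type} [Group A] [TopologicalSpace A] [NonarchimedeanGroup A] [LocallyCompactSpace A] [SecondCountableTopology A]
  {W : Type} [AddCommGroup W] [Module ℂ W]

/-- **The `GL₂`-block of an irreducible smooth supercuspidal representation of `M ≅ GL₂(F) × A` (`A` commutative).**  Along a topological group isomorphism
`E : GL₂(F) × A ≃ M`: there is a character `χ` of `A` with open kernel through which `A` acts (`σ (E (g,a)) = χ a • σ (E (g,1))`), and `σ ∘ E ∘ inl` is irreducible,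
admissible and supercuspidal. [cite: Casselman1995, Thm. 5.4.1] [cite: BushnellHenniart2006, §2.6 Cor. 1, §9.1, §10.1] -/
theorem exists_character_blockData_of_continuousMulEquiv (hA : ∀ a b : A, a * b = b * a) (E : (GL (Fin 2) F × A) ≃ₜ* M)
    (σ : Representation ℂ M W) [σ.IsIrreducible] (hσ : σ.IsSmooth) (hsc : σ.IsSupercuspidal) :
    ∃ χ : A →* ℂˣ, IsOpen ((χ.ker : Subgroup A) : Set A) ∧
      (∀ (g : GL (Fin 2) F) (a : A), (σ.comp E.toMonoidHom : Representation ℂ (GL (Fin 2) F × A) W) (g, a) =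
        ((χ a : ℂˣ) : ℂ) • (σ.comp E.toMonoidHom : Representation ℂ (GL (Fin 2) F × A) W) (g, 1)) ∧
      Representation.IsIrreducible ((σ.comp E.toMonoidHom : Representation ℂ (GL (Fin 2) F × A) W).comp (MonoidHom.inl (GL (Fin 2) F) A)) ∧
      Representation.IsAdmissible ((σ.comp E.toMonoidHom : Representation ℂ (GL (Fin 2) F × A) W).comp (MonoidHom.inl (GL (Fin 2) F) A)) ∧
      Representation.IsSupercuspidal ((σ.comp E.toMonoidHom : Representation ℂ (GL (Fin 2) F × A) W).comp (MonoidHom.inl (GL (Fin 2) F) A)) := by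
  haveI : IsTopologicalRing F := inferInstance
  haveI : NonarchimedeanGroup (GL (Fin 2) F) := nonarchimedeanGroup_gl F 2
  haveI : SecondCountableTopology (GL (Fin 2) F) := K2E3GLnIntegerPointsHaarVsAddHaar.secondCountableTopology_gl
  haveI : LocallyCompactSpace (GL (Fin 2) F) := K2E3GLnIntegerPointsHaarVsAddHaar.locallyCompactSpace_gl
  -- `σ' = σ ∘ E` on `GL₂(F) × A`
  haveI hirr' : Representation.IsIrreducible (σ.comp E.toMonoidHom : Representation ℂ (GL (Fin 2) F × A) W) :=
    Representation.IsIrreducible.comp_of_surjective ‹σ.IsIrreducible› E.toMonoidHom E.surjective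
  have hsm' : Representation.IsSmooth (σ.comp E.toMonoidHom : Representation ℂ (GL (Fin 2) F × A) W) :=
    IsSmooth.comp_of_continuous σ E.toMonoidHom E.continuous hσ
  have hsc' : Representation.IsSupercuspidal (σ.comp E.toMonoidHom : Representation ℂ (GL (Fin 2) F × A) W) :=
    hsc.comp_mulEquiv E.toMulEquiv E.toHomeomorph.isOpenMap
  have hadm' : Representation.IsAdmissible (σ.comp E.toMonoidHom : Representation ℂ (GL (Fin 2) F × A) W) :=
    Representation.IsSupercuspidal.isAdmissible_holds hsm' hsc'
  obtain ⟨χ, hχo, hχ⟩ := exists_character_of_central_factor (σ.comp E.toMonoidHom : Representation ℂ (GL (Fin 2) F × A) W) hadm' hA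
  exact ⟨χ, hχo, hχ, isIrreducible_comp_inl _ hχ, isAdmissible_comp_inl _ hadm' hχo hχ, isSupercuspidal_comp_inl _ hsc' hχo hχ⟩

end Block

/-! ## §2 No non-zero `M`-map from a subrepresentation of a block principal series onto a supercuspidal `σ` -/

section NoQuotient

variable {M : Type} [Group M] {W : Type} [AddCommGroup W] [Module ℂ W]

/-- **THE BLOCK FORM OF CASSELMAN'S COR. 5.4.3.**  `ι : GL₂(F) → M` with `σ₂ = σ ∘ ι` (pointwise, `hσ₂`) irreducible admissible supercuspidal; `Y` an `M`-representation with an injective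
`GL₂`-equivariant linear map `j : Y → I₂(χ₂) := parabolicIndGL F (id : Fin 2 → Fin 2) (𝟙.twist χ₂)` into a principal series of `GL₂(F)` (`χ₂` ANY character of the
diagonal torus); then every `M`-map from an `M`-subrepresentation `N ≤ Y` to `σ` is zero (the image `j(N) ≤ I₂(χ₂)` is a `GL₂`-subrepresentation mapping onto `σ ∘ ι`,
and ★ `intertwiningMap_subrepresentation_parabolicIndGL_eq_zero` kills that map). [cite: Casselman1995, Cor. 5.4.3, Thm. 5.4.1, Prop. 5.1.1]
[cite: BernsteinZelevinsky1977, Thm. 2.4 (d), Cor. 2.13 (b)] -/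
theorem intertwiningMap_subrepresentation_eq_zero_of_blockEmbedding (ι : GL (Fin 2) F →* M) {σ : Representation ℂ M W}
    (σ₂ : Representation ℂ (GL (Fin 2) F) W) (hσ₂ : ∀ (g : GL (Fin 2) F) (w : W), σ₂ g w = σ (ι g) w)
    (hirr : σ₂.IsIrreducible) (hadm : σ₂.IsAdmissible) (hsc : σ₂.IsSupercuspidal)
    (χ₂ : (Π a : Fin 2, GL {i : Fin 2 // (id : Fin 2 → Fin 2) i = a} F) →* ℂˣ) {XY : Type} [AddCommGroup XY] [Module ℂ XY] (Y : Representation ℂ M XY)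
    (j : XY →ₗ[ℂ] Representation.SmoothInd (standardParabolicGL F (id : Fin 2 → Fin 2))
      (Representation.twist (((Representation.trivial ℂ (Π a : Fin 2, GL {i : Fin 2 // (id : Fin 2 → Fin 2) i = a} F) ℂ).twist χ₂).comp
        (leviProjection F (id : Fin 2 → Fin 2))) (rootDeltaChar (standardParabolicGL F (id : Fin 2 → Fin 2)))))
    (hj : ∀ (g : GL (Fin 2) F) (v : XY), j (Y (ι g) v) = (Representation.parabolicIndGL F (id : Fin 2 → Fin 2)
      ((Representation.trivial ℂ (Π a : Fin 2, GL {i : Fin 2 // (id : Fin 2 → Fin 2) i = a} F) ℂ).twist χ₂)) g (j v))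
    (hjinj : Function.Injective j)
    (N : Subrepresentation Y) (q : N.toRepresentation.IntertwiningMap σ) : q = 0 := by
  haveI := hirr
  -- the image `N₂ = j(N) ≤ I₂(χ₂)`, a `GL₂`-subrepresentation
  let N₂ : Subrepresentation (Representation.parabolicIndGL F (id : Fin 2 → Fin 2)
      ((Representation.trivial ℂ (Π a : Fin 2, GL {i : Fin 2 // (id : Fin 2 → Fin 2) i = a} F) ℂ).twist χ₂)) :=
    { toSubmodule := N.toSubmodule.map j
      apply_mem_toSubmodule := fun g w hw => by
        obtain ⟨v, hv, rfl⟩ := hw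
        exact ⟨Y (ι g) v, N.apply_mem_toSubmodule (ι g) hv, hj g v⟩ }
  -- `j` restricted: `N ≃ N₂`
  let eN : N.toSubmodule ≃ₗ[ℂ] N₂.toSubmodule := Submodule.equivMapOfInjective j hjinj N.toSubmodule
  -- the transported map `q₂ : N₂ → σ ∘ ι`
  let q₂ : N₂.toRepresentation.IntertwiningMap σ₂ :=
    { toLinearMap := q.toLinearMap ∘ₗ eN.symm.toLinearMap
      isIntertwining' := fun g => LinearMap.ext fun w => by
        obtain ⟨v, rfl⟩ := eN.surjective w
        have hgv : N₂.toRepresentation g (eN v) = eN (N.toRepresentation (ι g) v) := by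
          apply Subtype.ext
          show (Representation.parabolicIndGL F (id : Fin 2 → Fin 2)
            ((Representation.trivial ℂ (Π a : Fin 2, GL {i : Fin 2 // (id : Fin 2 → Fin 2) i = a} F) ℂ).twist χ₂)) g (j (v : XY)) = j (Y (ι g) (v : XY))
          rw [hj]
        simp only [LinearMap.coe_comp, LinearEquiv.coe_toLinearMap, Function.comp_apply, hgv, LinearEquiv.symm_apply_apply, hσ₂]
        exact Representation.IntertwiningMap.isIntertwining _ _ q (ι g) v }
  have hq₂ : q₂ = 0 :=
    intertwiningMap_subrepresentation_parabolicIndGL_eq_zero (F := F) (c := (id : Fin 2 → Fin 2))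
      (σ := (Representation.trivial ℂ (Π a : Fin 2, GL {i : Fin 2 // (id : Fin 2 → Fin 2) i = a} F) ℂ).twist χ₂)
      (π := σ₂) monotone_id ⟨Function.surjective_id, inferInstance⟩ (fun u => ⟨_, fun w => rfl⟩) hadm hsc N₂ q₂
  refine Representation.IntertwiningMap.ext (LinearMap.ext fun v => ?_)
  have h := congrArg (fun f : N₂.toRepresentation.IntertwiningMap σ₂ => f (eN v)) hq₂
  have h2 : q₂ (eN v) = q v := by
    show q (eN.symm (eN v)) = q v
    rw [LinearEquiv.symm_apply_apply]
  rw [h2] at h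
  exact h

end NoQuotient

/-! ## §3 The two-block Levi of `P₂₁ ≤ GL₃(F)`: the block embedding and its properties -/

section TwoOne

/-- **THE BLOCK EMBEDDING OF THE LEVI OF `P₂₁`.**  There is a homomorphism `ι : GL₂(F) → Π_a GL {i // ![0,0,1] i = a} F`, `ι g = proj_Q m` for an `m ∈ Q` with block
matrix `diag(g, 1)`, such that for EVERY irreducible smooth supercuspidal `σ` of the Levi the block representation `σ₂ g = σ (ι g)` is irreducible, admissible and
supercuspidal (§1 along ★ `exists_continuousMulEquiv_levi_two_one`).  With §2 this is the `M_c`-input of the weak cell lemma for `c = ![0,0,1]`.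
[cite: Casselman1995, Thm. 5.4.1, Cor. 5.4.3] [cite: BushnellHenniart2006, §9.1, §10.1] -/
theorem exists_blockEmbedding_twoOne :
    ∃ ι : GL (Fin 2) F →* (Π a, GL {i // (![0, 0, 1] : Fin 3 → Fin 2) i = a} F),
      (∀ g : GL (Fin 2) F, ∃ m : ↥(standardParabolicGL F (![0, 0, 1] : Fin 3 → Fin 2)),
        ι g = leviProjection F (![0, 0, 1] : Fin 3 → Fin 2) m ∧
        ((m : GL (Fin 3) F) : Matrix (Fin 3) (Fin 3) F) =
          !![(g : Matrix (Fin 2) (Fin 2) F) 0 0, (g : Matrix (Fin 2) (Fin 2) F) 0 1, 0;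
             (g : Matrix (Fin 2) (Fin 2) F) 1 0, (g : Matrix (Fin 2) (Fin 2) F) 1 1, 0;
             0, 0, 1]) ∧
      ∀ {W : Type} [AddCommGroup W] [Module ℂ W] (σ : Representation ℂ (Π a, GL {i // (![0, 0, 1] : Fin 3 → Fin 2) i = a} F) W),
        σ.IsIrreducible → σ.IsSmooth → σ.IsSupercuspidal →
          ∃ σ₂ : Representation ℂ (GL (Fin 2) F) W, (∀ (g : GL (Fin 2) F) (w : W), σ₂ g w = σ (ι g) w) ∧
            σ₂.IsIrreducible ∧ σ₂.IsAdmissible ∧ σ₂.IsSupercuspidal := by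
  haveI : IsTopologicalRing F := inferInstance
  haveI : NonarchimedeanGroup (GL (Fin 1) F) := nonarchimedeanGroup_gl F 1
  haveI : SecondCountableTopology (GL (Fin 1) F) := K2E3GLnIntegerPointsHaarVsAddHaar.secondCountableTopology_gl
  haveI : LocallyCompactSpace (GL (Fin 1) F) := K2E3GLnIntegerPointsHaarVsAddHaar.locallyCompactSpace_gl
  obtain ⟨E, hE⟩ := K2E3GL3CuspidalBlockRestriction.exists_continuousMulEquiv_levi_two_one F
  refine ⟨E.toMonoidHom.comp (MonoidHom.inl (GL (Fin 2) F) (GL (Fin 1) F)), fun g => ?_, ?_⟩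
  · obtain ⟨m, hm, hmat⟩ := hE (g, 1)
    refine ⟨m, hm, ?_⟩
    rw [hmat, Units.val_one, Matrix.one_apply_eq]
  · intro W _ _ σ hirr hσ hsc
    -- `GL₁(F)` is commutative (★ `K2E3GLTwoRamifiedShellStabilizers.glOne_mul_comm`, re-proved inline to keep the import list light)
    have hcomm : ∀ a b : GL (Fin 1) F, a * b = b * a := fun a b => by
      refine Units.ext (Matrix.ext fun i j => ?_)
      rw [Units.val_mul, Units.val_mul, Matrix.mul_apply, Matrix.mul_apply, Fintype.sum_subsingleton _ i, Fintype.sum_subsingleton _ i,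
        Subsingleton.elim j i, mul_comm]
    obtain ⟨χ, -, -, h1, h2, h3⟩ := exists_character_blockData_of_continuousMulEquiv hcomm E σ hσ hsc
    exact ⟨_, fun g w => rfl, h1, h2, h3⟩

end TwoOne

/-! ## §4 (ED. 2) The RELATIVE block form: a cell map `Ψ : A → I₂(χ₂)` that need not be injective, `q` killing `ker Ψ` -/

section Relative

variable {M : Type} [Group M] {W : Type} [AddCommGroup W] [Module ℂ W]

/-- **THE RELATIVE BLOCK FORM OF CASSELMAN'S COR. 5.4.3** (the shape of K2E3-p14 (g7)'s (E4b-2■), K2 bus 12:00:25Z).  `ι : GL₂(F) → M`, `σ₂ g = σ (ι g)` irreducible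
admissible supercuspidal; `V` an `M`-representation, `A ≤ V` an `M`-subrepresentation carrying a `GL₂`-equivariant linear CELL MAP `Ψ : A → I₂(χ₂)` (not necessarily
injective); `N ≤ A` an `M`-subrepresentation and `q : N → σ` an `M`-map vanishing on `N ∩ ker Ψ`.  Then `q = 0`: `q` factors through the `GL₂`-subrepresentation
`Ψ(N) ≤ I₂(χ₂)` as a `GL₂`-map onto `σ₂`, which ★ `intertwiningMap_subrepresentation_parabolicIndGL_eq_zero` annihilates.
[cite: Casselman1995, Cor. 5.4.3, Thm. 5.4.1, Prop. 5.1.1] [cite: BernsteinZelevinsky1977, Thm. 2.4 (d), Cor. 2.13 (b)] -/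
theorem intertwiningMap_subrepresentation_eq_zero_of_blockMap (ι : GL (Fin 2) F →* M) {σ : Representation ℂ M W}
    (σ₂ : Representation ℂ (GL (Fin 2) F) W) (hσ₂ : ∀ (g : GL (Fin 2) F) (w : W), σ₂ g w = σ (ι g) w)
    (hirr : σ₂.IsIrreducible) (hadm : σ₂.IsAdmissible) (hsc : σ₂.IsSupercuspidal)
    (χ₂ : (Π a : Fin 2, GL {i : Fin 2 // (id : Fin 2 → Fin 2) i = a} F) →* ℂˣ) {XV : Type} [AddCommGroup XV] [Module ℂ XV] (V : Representation ℂ M XV)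
    (A : Subrepresentation V)
    (Ψ : A.toSubmodule →ₗ[ℂ] Representation.SmoothInd (standardParabolicGL F (id : Fin 2 → Fin 2))
      (Representation.twist (((Representation.trivial ℂ (Π a : Fin 2, GL {i : Fin 2 // (id : Fin 2 → Fin 2) i = a} F) ℂ).twist χ₂).comp
        (leviProjection F (id : Fin 2 → Fin 2))) (rootDeltaChar (standardParabolicGL F (id : Fin 2 → Fin 2)))))
    (hΨ : ∀ (g : GL (Fin 2) F) (a : A.toSubmodule), Ψ ⟨V (ι g) (a : XV), A.apply_mem_toSubmodule (ι g) a.2⟩ =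
      (Representation.parabolicIndGL F (id : Fin 2 → Fin 2)
        ((Representation.trivial ℂ (Π a : Fin 2, GL {i : Fin 2 // (id : Fin 2 → Fin 2) i = a} F) ℂ).twist χ₂)) g (Ψ a))
    (N : Subrepresentation V) (hNA : N.toSubmodule ≤ A.toSubmodule) (q : N.toRepresentation.IntertwiningMap σ)
    (hq : ∀ x : N.toSubmodule, Ψ ⟨(x : XV), hNA x.2⟩ = 0 → q x = 0) : q = 0 := by
  haveI := hirr
  -- `φ = Ψ ∘ (N ↪ A)`, and `q` kills `ker φ`
  let φ : N.toSubmodule →ₗ[ℂ] Representation.SmoothInd (standardParabolicGL F (id : Fin 2 → Fin 2))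
      (Representation.twist (((Representation.trivial ℂ (Π a : Fin 2, GL {i : Fin 2 // (id : Fin 2 → Fin 2) i = a} F) ℂ).twist χ₂).comp
        (leviProjection F (id : Fin 2 → Fin 2))) (rootDeltaChar (standardParabolicGL F (id : Fin 2 → Fin 2)))) :=
    Ψ ∘ₗ Submodule.inclusion hNA
  have hφ : ∀ x : N.toSubmodule, φ x = Ψ ⟨(x : XV), hNA x.2⟩ := fun x => rfl
  have hφg : ∀ (g : GL (Fin 2) F) (x : N.toSubmodule), φ (N.toRepresentation (ι g) x) =
      (Representation.parabolicIndGL F (id : Fin 2 → Fin 2)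
        ((Representation.trivial ℂ (Π a : Fin 2, GL {i : Fin 2 // (id : Fin 2 → Fin 2) i = a} F) ℂ).twist χ₂)) g (φ x) := fun g x => by
    rw [hφ, hφ, ← hΨ g ⟨(x : XV), hNA x.2⟩]
    rfl
  have hker : LinearMap.ker φ ≤ LinearMap.ker q.toLinearMap := fun x hx => by
    rw [LinearMap.mem_ker] at hx ⊢
    exact hq x (by rw [← hφ]; exact hx)
  -- the image `N₂ = φ(N) ≤ I₂(χ₂)`, a `GL₂`-subrepresentation
  let N₂ : Subrepresentation (Representation.parabolicIndGL F (id : Fin 2 → Fin 2)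
      ((Representation.trivial ℂ (Π a : Fin 2, GL {i : Fin 2 // (id : Fin 2 → Fin 2) i = a} F) ℂ).twist χ₂)) :=
    { toSubmodule := LinearMap.range φ
      apply_mem_toSubmodule := fun g w hw => by
        obtain ⟨x, rfl⟩ := hw
        exact ⟨N.toRepresentation (ι g) x, hφg g x⟩ }
  -- `q̄ : N₂ → σ₂`, `q̄ (φ x) = q x`
  let qbar : N₂.toSubmodule →ₗ[ℂ] W := ((LinearMap.ker φ).liftQ q.toLinearMap hker) ∘ₗ φ.quotKerEquivRange.symm.toLinearMap
  have hqbar : ∀ x : N.toSubmodule, qbar ⟨φ x, LinearMap.mem_range_self φ x⟩ = q x := fun x => by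
    show (LinearMap.ker φ).liftQ q.toLinearMap hker (φ.quotKerEquivRange.symm ⟨φ x, LinearMap.mem_range_self φ x⟩) = q x
    rw [LinearMap.quotKerEquivRange_symm_apply_image, Submodule.mkQ_apply, Submodule.liftQ_apply]
    rfl
  let q₂ : N₂.toRepresentation.IntertwiningMap σ₂ :=
    { toLinearMap := qbar
      isIntertwining' := fun g => LinearMap.ext fun w => by
        obtain ⟨x, hx⟩ : ∃ x : N.toSubmodule, (⟨φ x, LinearMap.mem_range_self φ x⟩ : N₂.toSubmodule) = w := by
          obtain ⟨x, hx⟩ := w.2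
          exact ⟨x, Subtype.ext hx⟩
        subst hx
        have hgx : N₂.toRepresentation g ⟨φ x, LinearMap.mem_range_self φ x⟩ =
            ⟨φ (N.toRepresentation (ι g) x), LinearMap.mem_range_self φ _⟩ := Subtype.ext (hφg g x).symm
        simp only [LinearMap.coe_comp, Function.comp_apply, hgx, hqbar, hσ₂]
        exact Representation.IntertwiningMap.isIntertwining _ _ q (ι g) x }
  have hq₂ : q₂ = 0 :=
    intertwiningMap_subrepresentation_parabolicIndGL_eq_zero (F := F) (c := (id : Fin 2 → Fin 2))
      (σ := (Representation.trivial ℂ (Π a : Fin 2, GL {i : Fin 2 // (id : Fin 2 → Fin 2) i = a} F) ℂ).twist χ₂)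
      (π := σ₂) monotone_id ⟨Function.surjective_id, inferInstance⟩ (fun u => ⟨_, fun w => rfl⟩) hadm hsc N₂ q₂
  refine Representation.IntertwiningMap.ext (LinearMap.ext fun x => ?_)
  have h := congrArg (fun f : N₂.toRepresentation.IntertwiningMap σ₂ => f ⟨φ x, LinearMap.mem_range_self φ x⟩) hq₂
  have h2 : q₂ ⟨φ x, LinearMap.mem_range_self φ x⟩ = q x := hqbar x
  rw [h2] at h
  exact h

end Relative

end Summit.HodgeConjecture.HodgeConjecture.Cruxes.H413.K2E3LeviPrincipalSeriesNoSupercuspidal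

end
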